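import Summits.ABC.IUTFork.Cor312GenuineKTwistLowerBound
import Literature.IUT.LogVolume.GenuineThetaFieldTateRoot
import Literature.IUT.LogVolume.GenuineThetaFieldLegendreTwist
import Literature.IUT.LogVolume.Corollary22TorsionCoordinates
import Literature.NumberTheory.EllipticCurves.TateCurve.NumberField
import Literature.NumberTheory.EllipticCurves.TateCurve.SquareLemma
import HarnessLib

/-!
# [IUTchIII] Cor. 3.12, branch C / R-W window table — the TWIST factor `2` of the local type WITHOUT the model clause: at a bad place `w ∣ p`
# of the field `F` of a genuine Θ-volume datum over a rational point, `γ(E_λ) = −c₄/c₆` of the Legendre curve is a SQUARE in `F_w`, hence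
# `e(w ∣ p)·ord_p γ(E_λ)` is even; `ord_p γ(E_λ)` odd ⟹ `2 ∣ e(w ∣ p)` and `2·l ∣ e(K_{x₀}/ℚ_p)`

PROOF-ONLY support file (D-0012; 0 definitions, 0 `Prop` facts, no instance) of the abc-iut cell (R-W «WINDOW Θ-SIDE INEQUALITY», seat abc-iut-W-neg-1
gen 4, row «W:REF-BANDS-EXACT», sequel «W:TWIST-EXACT» of abc-iut-W-neg-2's `Cor312GenuineKTwistLowerBound` p475369). TAKES NO SIDE on [IUTchIII]
Cor. 3.12 (S. Mochizuki, *Inter-universal Teichmüller theory III*, RIMS manuscript, Cor. 3.12 p. 173–174) or on any author.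

THE POINT. abc-iut-W-neg-2's file states the twist factor `2` of the R-W numerics («`v_p(c)` odd ⇒ local type `2e₀`») with the MODEL clause `√y ∈ F` as a
hypothesis, because the typed datum `Cor22.ThetaVolumeDatumAt (ratPoint λ) l` pins `F` only inside print's range. This file derives it from the datum
ALONE, for the right `y`: the datum's curve `E_F` has SPLIT multiplicative reduction at every place `w` of `F` over a bad place (abc-iut-W-neg-1's
`hasSplitMultiplicativeReductionAt_F_of_badPlaces`, p467210: the `3²` rational `3`-torsion points), so by Tate's uniformisation (the tree's
`exists_tateParameter_of_hasSplitMultiplicativeReductionAt`, Silverman *ATAEC* V.5.3) `E_F ≅ E_q` over `F_w` and `γ(E_F/F_w) = −c₄/c₆ ∈ (F_w^×)²`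
(*ATAEC* Lemma V.5.2, the tree's `isSquare_gamma_of_iso_tateCurve`); at a rational point `E_F ≅_F E_λ` (the Legendre curve, abc-iut-W-ref lineage's
`exists_variableChange_thetaCurve_ratPoint`) and `γ` is a variable-change invariant up to squares (`isSquare_gamma_variableChange_iff`), so
`γ(E_λ) = −(λ²−λ+1)/(2(λ+1)(2λ−1)(λ−2)) ∈ ℚ` is a square in `F_w`, whence `ord_w γ(E_λ) = e(w∣p)·ord_p γ(E_λ)` is EVEN. At a pole `p ∣ c` of an abc
triple `λ = a/c` one has `ord_p γ(E_λ) = v_p(c)`; when this is ODD, `2 ∣ e(w ∣ p)` — the R-W numerics lead's desk rule (W-num-3 16:58:08Z, WINDOW-TABLE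
`type_status`: «`t` odd ∧ `p ∣ c` ⇒ `{2e₀}`») becomes a theorem about the typed datum.

* §1 `Cor22.even_ord_of_isSquare_adicCompletion` — `y ≠ 0` a square in `F_w` ⟹ `ord_w y` even (valuation on the completion).
* §2 **`Conditional.GenuineK.isSquare_gamma_legendre_adicCompletion`** — at a place `w` of `F` over a bad place: `γ(E_λ) ∈ ℚ` is a square in `F_w`;
  **`Conditional.GenuineK.two_dvd_ramificationIdx_F_of_odd_ord_gamma`** — `ord_p γ(E_λ)` odd ⟹ `2 ∣ e(w ∣ p)`.
* §3 **`Conditional.GenuineK.two_dvd_absRamificationIdx_kOf_of_odd_ord_gamma`** — fibre form `2 ∣ e(K_{x₀}/ℚ_p)` at every fibre point `x₀ ∣ p` of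
  `pilotDataOfK T.D T.K`; **`…two_mul_prime_dvd_absRamificationIdx_kOf_of_odd_ord_gamma`** — `2·l ∣ e(K_{x₀}/ℚ_p)` at a rational pole `p ∉ {2, l}`.
`γ(E_λ)` is written as `−(W₀.c₄/W₀.c₆)` for the literal Legendre curve `W₀ = ⟨0, −(1+λ), 0, λ, 0⟩` over `ℚ` (no definition introduced); consumers
evaluate `ord_p` of this rational number per datum. HONEST FRAMING: bookkeeping over OUR typed objects; nothing here bears on the printed inequality of
[IUTchIII] Cor. 3.12 or on the number-level `Cor22.Cor312AtDatum`; typed ≠ proved; instantiated ≠ endorsed.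
[cite: Mochizuki2012, IUTchIV Thm. 1.10 p. 22, Cor. 2.2 (ii) proof (P5) p. 46; IUTchI Ex. 3.2 (iv) p. 71] [cite: SilvermanATAEC1994, Lemma V.5.2 and Thm. V.5.3 (PDF pp. 406–409)]
[cite: NeukirchANT1999, Ch. II Prop. (6.8)] [claim: Mochizuki2012, status: disputed] for every IUT quotation.
-/

noncomputable section

open NumberField IsDedekindDomain

namespace Literature.IUT.LogVolume.Cor22

/-! ## §1. A square in the completion has even order -/

/-- **A nonzero element of `F` that is a square in `F_w` has EVEN `w`-order**: `|y|_w = |s|_w²` on the completion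
(Mathlib `valuedAdicCompletion_eq_valuation'`), and `ord_w y = −log |y|_w`. [cite: NeukirchANT1999, Ch. II Prop. (6.8)] -/
theorem even_ord_of_isSquare_adicCompletion {F : Type*} [Field F] [NumberField F] (w : HeightOneSpectrum (𝓞 F)) {y : F}
    (hy : y ≠ 0) (hsq : IsSquare (algebraMap F (w.adicCompletion F) y)) : Even (ord F w y) := by
  obtain ⟨s, hs⟩ := hsq
  have hv : Valued.v (algebraMap F (w.adicCompletion F) y) = w.valuation F y :=
    HeightOneSpectrum.valuedAdicCompletion_eq_valuation' w y
  have hy' : w.valuation F y ≠ 0 := (Valuation.ne_zero_iff _).mpr hy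
  have hs0 : Valued.v s ≠ 0 := by
    intro h
    apply hy'
    rw [← hv, hs, map_mul, h, mul_zero]
  obtain ⟨m, hm⟩ : ∃ m : ℤ, Valued.v s = WithZero.exp m := ⟨_, (WithZero.exp_log hs0).symm⟩
  refine ⟨-m, ?_⟩
  unfold ord
  rw [← hv, hs, map_mul, hm, ← WithZero.exp_add, WithZero.log_exp]
  ring

end Literature.IUT.LogVolume.Cor22

namespace Summit.ABC.IUTFork.Conditional

open Thm311 Thm311.Real Cor312 Cor312Prov Literature.IUT.LogVolume Literature.IUT.HodgeTheaters
  Literature.IUT.LogThetaLattice Literature.NumberTheory.NumberFields Literature.NumberTheory.DiophantineGeometry.GenEll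
  Literature.NumberTheory.DiophantineGeometry Literature.NumberTheory.EllipticCurves.TateCurve

/-! ## §2. `γ(E_λ)` is a square in `F_w` at a bad place; odd `ord_p γ(E_λ)` forces `2 ∣ e(w ∣ p)` -/

/-- **`γ(E_λ) = −c₄/c₆` of the Legendre curve is a SQUARE in `F_w` at every place `w` of `F` over a bad place of `λ ∈ ℚ`**, for a genuine Θ-volume datum
`T` over `ratPoint λ`: `E_F` is split multiplicative at `w` (p467210), `E_F ⊗ F_w ≅ E_q` (Tate, *ATAEC* V.5.3), `γ(E_q) ∈ (F_w^×)²` (*ATAEC* V.5.2), `E_F ≅_F E_λ`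
(`exists_variableChange_thetaCurve_ratPoint`; `j(λ) ≠ 1728` since `j` has a pole) and `γ` is a variable-change invariant up to squares; `E_λ ⊗ F_w` is the
base change of the rational Legendre curve `W₀ = ⟨0, −(1+λ), 0, λ, 0⟩`, so its `γ` is the image of `−(W₀.c₄/W₀.c₆) ∈ ℚ`.
[cite: SilvermanATAEC1994, Lemma V.5.2 and Thm. V.5.3 (PDF pp. 406–409)] [cite: Mochizuki2012, IUTchIV Thm. 1.10 p. 22] [claim: Mochizuki2012, status: disputed] -/
theorem GenuineK.isSquare_gamma_legendre_adicCompletion {q : ℚ} {l : ℕ} (T : Cor22.ThetaVolumeDatumAt (ratPoint q) l)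
    (w : letI := T.instFieldF; letI := T.instNumberFieldF; HeightOneSpectrum (𝓞 T.F))
    (hbad : letI := T.instFieldF; letI := T.instNumberFieldF; letI := T.instAlgebraF
      finBelow (ratPoint q).F T.F w ∈ Cor22.badPlaces (ratPoint q)) :
    letI := T.instFieldF; letI := T.instNumberFieldF; letI := T.instAlgebraF
    IsSquare (algebraMap T.F (w.adicCompletion T.F) (algebraMap (ratPoint q).F T.F
      (-((⟨0, -(1 + q), 0, q, 0⟩ : WeierstrassCurve ℚ).c₄ / (⟨0, -(1 + q), 0, q, 0⟩ : WeierstrassCurve ℚ).c₆)))) := by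
  letI := T.instFieldF; letI := T.instNumberFieldF; letI := T.instAlgebraF; letI := T.instIsElliptic
  haveI := charZero_adicCompletion' T.F w
  -- Tate uniformisation at the split multiplicative place `w`
  have hsplit := T.hasSplitMultiplicativeReductionAt_F_of_badPlaces w hbad
  obtain ⟨qw, -, hq1, -, -, C, hC⟩ := exists_tateParameter_of_hasSplitMultiplicativeReductionAt T.F w T.E hsplit
  have h12 : (12 : w.adicCompletion T.F) ≠ 0 := by norm_num
  have hγE : IsSquare (-((T.E.baseChange (w.adicCompletion T.F)).c₄ / (T.E.baseChange (w.adicCompletion T.F)).c₆)) :=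
    isSquare_gamma_of_iso_tateCurve hq1 h12 ⟨C, hC⟩
  -- `E_F ≅_F E_λ` (`j(λ) ≠ 1728`: `j` has a pole below `w`)
  have hj : Cor22.jInv q ≠ 1728 := by
    intro h
    have hlt := (Cor22.mem_badPlaces_iff_ord_neg (ratPoint q) (finBelow (ratPoint q).F T.F w)).mp hbad
    have hc : ((1728 : 𝓞 (ratPoint q).F) : (ratPoint q).F) = 1728 := by norm_cast
    have h' : Cor22.jInv (ratPoint q).x = ((1728 : 𝓞 (ratPoint q).F) : (ratPoint q).F) := by
      rw [hc]; exact h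
    rw [h'] at hlt
    exact absurd hlt (not_lt.mpr (ord_nonneg_of_isIntegral _ _ _))
  obtain ⟨C₀, hC₀⟩ := T.exists_variableChange_thetaCurve_ratPoint hj
  -- transport along the base change of `C₀`
  have hθ : (Cor22.thetaCurve (ratPoint q) T.F).baseChange (w.adicCompletion T.F) =
      (C₀.map (algebraMap T.F (w.adicCompletion T.F))) • (T.E.baseChange (w.adicCompletion T.F)) := by
    rw [← hC₀]
    exact (WeierstrassCurve.map_variableChange _ _ _).symm
  have hγθ : IsSquare (-(((Cor22.thetaCurve (ratPoint q) T.F).baseChange (w.adicCompletion T.F)).c₄ /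
      ((Cor22.thetaCurve (ratPoint q) T.F).baseChange (w.adicCompletion T.F)).c₆)) := by
    rw [hθ]
    exact (isSquare_gamma_variableChange_iff _ _).mpr hγE
  -- the Legendre curve over `F_w` is the base change of `W₀` over `ℚ`
  have hmap : (Cor22.thetaCurve (ratPoint q) T.F).baseChange (w.adicCompletion T.F) =
      (⟨0, -(1 + q), 0, q, 0⟩ : WeierstrassCurve ℚ).map
        ((algebraMap T.F (w.adicCompletion T.F)).comp (algebraMap (ratPoint q).F T.F)) := by
    rw [Cor22.thetaCurve_eq_map, WeierstrassCurve.baseChange, WeierstrassCurve.map_map]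
    rfl
  rw [hmap, WeierstrassCurve.map_c₄, WeierstrassCurve.map_c₆, ← map_div₀, ← map_neg] at hγθ
  exact hγθ

/-- **`ord_p γ(E_λ)` ODD ⟹ `2 ∣ e(w ∣ p)`** for every place `w ∣ p` of the field `F` of a genuine Θ-volume datum over a rational pole `p` of `j(λ)`:
`ord_w γ(E_λ) = e(w ∣ p)·ord_p γ(E_λ)` (Neukirch II (6.8), the tree's `Cor22.ord_algebraMap_eq`) is even by §1 and
`GenuineK.isSquare_gamma_legendre_adicCompletion`. NO model clause (contrast abc-iut-W-neg-2's `…_of_isSquare`).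
[cite: NeukirchANT1999, Ch. II Prop. (6.8)] [cite: SilvermanATAEC1994, Lemma V.5.2] [cite: Mochizuki2012, IUTchIV Thm. 1.10 p. 22] [claim: Mochizuki2012, status: disputed] -/
theorem GenuineK.two_dvd_ramificationIdx_F_of_odd_ord_gamma {q : ℚ} {l : ℕ} (T : Cor22.ThetaVolumeDatumAt (ratPoint q) l)
    (pp : Nat.Primes)
    (hpole : ∀ v : HeightOneSpectrum (𝓞 ℚ), Rat.HeightOneSpectrum.natGenerator v = pp →
      Literature.IUT.LogVolume.ord ℚ v (Cor22.jInv q) < 0)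
    (hodd : ∀ v : HeightOneSpectrum (𝓞 ℚ), Rat.HeightOneSpectrum.natGenerator v = pp →
      Odd (Literature.IUT.LogVolume.ord ℚ v
        (-((⟨0, -(1 + q), 0, q, 0⟩ : WeierstrassCurve ℚ).c₄ / (⟨0, -(1 + q), 0, q, 0⟩ : WeierstrassCurve ℚ).c₆))))
    (w : letI := T.instFieldF; letI := T.instNumberFieldF; HeightOneSpectrum (𝓞 T.F))
    (hw : letI := T.instFieldF; letI := T.instNumberFieldF; ((pp : ℕ) : 𝓞 T.F) ∈ w.asIdeal) :
    2 ∣ (letI := T.instFieldF; letI := T.instNumberFieldF; w.asIdeal.ramificationIdx ℤ) := by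
  -- adapted from abc-iut-W-neg-2's `GenuineK.two_dvd_ramificationIdx_F_of_isSquare` (Cor312GenuineKTwistLowerBound.lean)
  letI := T.instFieldF; letI := T.instNumberFieldF; letI := T.instAlgebraF
  haveI : Fact (pp : ℕ).Prime := ⟨pp.2⟩
  set y : ℚ := -((⟨0, -(1 + q), 0, q, 0⟩ : WeierstrassCurve ℚ).c₄ / (⟨0, -(1 + q), 0, q, 0⟩ : WeierstrassCurve ℚ).c₆) with hydef
  -- the place of `ℚ` under `w` is `p`
  set v : HeightOneSpectrum (𝓞 ℚ) := finBelow (ratPoint q).F T.F w with hvdef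
  have hwchar : residueChar T.F w = (pp : ℕ) := residueChar_eq_of_natCast_mem pp.1 hw
  have hvp : Rat.HeightOneSpectrum.natGenerator v = pp := by
    have hchar : residueChar ℚ v = pp := by
      rw [hvdef]
      change residueChar (ratPoint q).F (finBelow (ratPoint q).F T.F w) = pp
      rw [residueChar_finBelow, hwchar]
    have hmem : ((pp : ℕ) : 𝓞 ℚ) ∈ v.asIdeal := by
      rw [Cor22.natCast_mem_asIdeal_iff_residueChar_eq v pp.2]; exact hchar
    have hdvd := (UniformABCConjecture.natCast_mem_asIdeal_iff v pp).1 hmem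
    exact (Nat.prime_dvd_prime_iff_eq (Rat.HeightOneSpectrum.prime_natGenerator v) pp.2).1 hdvd
  -- `w` lies over a bad place, so `y` is a square in `F_w`, and `ord_w y` is even
  have hbad : finBelow (ratPoint q).F T.F w ∈ Cor22.badPlaces (ratPoint q) := by
    rw [Cor22.mem_badPlaces_iff_ord_neg]
    exact hpole v hvp
  have hodd' : Odd (Literature.IUT.LogVolume.ord ℚ v y) := hodd v hvp
  have hy0 : y ≠ 0 := by
    intro h
    rw [h, ord_zero] at hodd'
    exact (Int.not_odd_iff_even.mpr (by decide)) hodd'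
  have hY0 : algebraMap (ratPoint q).F T.F y ≠ 0 := (map_ne_zero _).mpr hy0
  have heven : Even (Literature.IUT.LogVolume.ord T.F w (algebraMap (ratPoint q).F T.F y)) :=
    Cor22.even_ord_of_isSquare_adicCompletion w hY0 (GenuineK.isSquare_gamma_legendre_adicCompletion T w hbad)
  -- `ord_w(y) = e(w|v)·ord_v(y)` with `ord_v(y)` odd ⟹ `e(w|v)` even
  have h1 := Cor22.ord_algebraMap_eq (F := (ratPoint q).F) (K := T.F) w y
  have heven' : Even (((finBelow (ratPoint q).F T.F w).asIdeal.ramificationIdx' w.asIdeal : ℤ)) := by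
    have hprod : Even ((((finBelow (ratPoint q).F T.F w).asIdeal.ramificationIdx' w.asIdeal : ℕ) : ℤ) *
        Literature.IUT.LogVolume.ord ℚ v y) := by
      change Even ((((finBelow (ratPoint q).F T.F w).asIdeal.ramificationIdx' w.asIdeal : ℕ) : ℤ) *
        Literature.IUT.LogVolume.ord (ratPoint q).F (finBelow (ratPoint q).F T.F w) y)
      rw [← h1]; exact heven
    rcases Int.even_mul.mp hprod with he | he
    · exact he
    · exact absurd he (Int.not_even_iff_odd.mpr hodd')
  have heven'' : 2 ∣ (finBelow (ratPoint q).F T.F w).asIdeal.ramificationIdx' w.asIdeal := by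
    have := even_iff_two_dvd.mp heven'
    exact_mod_cast this
  -- `e(w | p) = e(w | v)` over `ℚ`
  have hew : w.asIdeal.ramificationIdx ℤ = (finBelow (ratPoint q).F T.F w).asIdeal.ramificationIdx' w.asIdeal := by
    have h1' : ramIdx (ratPoint q).F (w.under (𝓞 (ratPoint q).F)) = 1 := by
      rw [ramIdx_eq]
      exact Literature.NumberTheory.EllipticCurves.Fisher2016.ramificationIdx_int_rat_eq_one _
    rw [ThetaData.absRamificationIdx_eq_ramIdx_mul (F := (ratPoint q).F) w]
    erw [h1', one_mul]
    rfl
  rw [hew]; exact heven''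

/-! ## §3. Fibre forms at the `K`-level pilot datum -/

/-- **Fibre form: `ord_p γ(E_λ)` odd at a rational pole `p` of `j(λ)` ⟹ `2 ∣ e(K_{x₀}/ℚ_p)` at EVERY fibre point `x₀ ∣ p`** of `pilotDataOfK T.D T.K`
(`e(K_{x₀}/ℚ_p) = e(w ∣ p)·e(x₀ ∣ w)`, `w = x₀ ∩ 𝓞_F`). [cite: NeukirchANT1999, Ch. II Prop. (6.8)] [cite: Mochizuki2012, IUTchIV Thm. 1.10 p. 22] [claim: Mochizuki2012, status: disputed] -/
theorem GenuineK.two_dvd_absRamificationIdx_kOf_of_odd_ord_gamma {q : ℚ} {l : ℕ} (T : Cor22.ThetaVolumeDatumAt (ratPoint q) l)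
    (pp : Nat.Primes)
    (hpole : ∀ v : HeightOneSpectrum (𝓞 ℚ), Rat.HeightOneSpectrum.natGenerator v = pp →
      Literature.IUT.LogVolume.ord ℚ v (Cor22.jInv q) < 0)
    (hodd : ∀ v : HeightOneSpectrum (𝓞 ℚ), Rat.HeightOneSpectrum.natGenerator v = pp →
      Odd (Literature.IUT.LogVolume.ord ℚ v
        (-((⟨0, -(1 + q), 0, q, 0⟩ : WeierstrassCurve ℚ).c₄ / (⟨0, -(1 + q), 0, q, 0⟩ : WeierstrassCurve ℚ).c₆)))) :
    letI := T.instFieldF; letI := T.instNumberFieldF; letI := T.instAlgebraF; letI := T.instFieldK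
    letI := T.instNumberFieldK; letI := T.instAlgebraK; letI := T.instFieldFbar; letI := T.instAlgebraFbar
    letI := T.instAlgebraKFbar; letI := T.instIsElliptic
    haveI : Fact (pp : ℕ).Prime := ⟨pp.2⟩
    ∀ x₀ : (thetaIndex (pilotDataOfK T.D T.K)).Fibre (.inr pp),
      2 ∣ absRamificationIdx (pp : ℕ) (kOf (pilotDataOfK T.D T.K) pp.1 x₀) := by
  -- adapted from abc-iut-W-neg-2's `GenuineK.two_dvd_absRamificationIdx_kOf_of_isSquare`
  letI := T.instFieldF; letI := T.instNumberFieldF; letI := T.instAlgebraF; letI := T.instFieldK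
  letI := T.instNumberFieldK; letI := T.instAlgebraK; letI := T.instFieldFbar; letI := T.instAlgebraFbar
  letI := T.instAlgebraKFbar; letI := T.instIsElliptic
  haveI : Fact (pp : ℕ).Prime := ⟨pp.2⟩
  intro x₀
  have hpu : ((pp : ℕ) : 𝓞 T.K) ∈ (placeOf (pilotDataOfK T.D T.K) pp.1 x₀).asIdeal := natCast_mem_placeOf (pilotDataOfK T.D T.K) pp.1 x₀
  have hekOf : absRamificationIdx (pp : ℕ) (kOf (pilotDataOfK T.D T.K) pp.1 x₀) =
      (placeOf (pilotDataOfK T.D T.K) pp.1 x₀).asIdeal.ramificationIdx ℤ :=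
    absRamificationIdx_rescaledCompletion T.K (pp : ℕ) _ hpu
  have hpw : ((pp : ℕ) : 𝓞 T.F) ∈ (finBelow T.F T.K (placeOf (pilotDataOfK T.D T.K) pp.1 x₀)).asIdeal := by
    change ((pp : ℕ) : 𝓞 T.F) ∈ Ideal.comap (algebraMap (𝓞 T.F) (𝓞 T.K)) (placeOf (pilotDataOfK T.D T.K) pp.1 x₀).asIdeal
    rw [Ideal.mem_comap, map_natCast]
    exact hpu
  have hF : 2 ∣ (finBelow T.F T.K (placeOf (pilotDataOfK T.D T.K) pp.1 x₀)).asIdeal.ramificationIdx ℤ :=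
    GenuineK.two_dvd_ramificationIdx_F_of_odd_ord_gamma T pp hpole hodd _ hpw
  rw [hekOf, ThetaData.absRamificationIdx_eq_ramIdx_mul (F := T.F) (placeOf (pilotDataOfK T.D T.K) pp.1 x₀), ramIdx_eq]
  exact dvd_mul_of_dvd_left hF _

/-- **`2·l ∣ e(K_{x₀}/ℚ_p)` at every fibre point over a rational pole `p ∉ {2, l}` of `j(λ)` with `ord_p γ(E_λ)` odd** — the twist factor `2` of
`e(w ∣ p)` (§2) times the exact `l` of the `l`-division layer (abc-iut-W-neg-1's `GenuineK.absRamificationIdx_kOf_eq_mul_prime_ratPoint`): the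
LOWER half of W-num-3's rule «`v_p(c)` odd ⇒ `{2e₀}`» with NO model clause. [cite: Mochizuki2012, IUTchI Ex. 3.2 (iv) p. 71] [claim: Mochizuki2012, status: disputed] -/
theorem GenuineK.two_mul_prime_dvd_absRamificationIdx_kOf_of_odd_ord_gamma {q : ℚ} {l : ℕ}
    (T : Cor22.ThetaVolumeDatumAt (ratPoint q) l) (pp : Nat.Primes) (hp2 : (pp : ℕ) ≠ 2) (hpl : (pp : ℕ) ≠ l)
    (hpole : ∀ v : HeightOneSpectrum (𝓞 ℚ), Rat.HeightOneSpectrum.natGenerator v = pp →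
      Literature.IUT.LogVolume.ord ℚ v (Cor22.jInv q) < 0)
    (hodd : ∀ v : HeightOneSpectrum (𝓞 ℚ), Rat.HeightOneSpectrum.natGenerator v = pp →
      Odd (Literature.IUT.LogVolume.ord ℚ v
        (-((⟨0, -(1 + q), 0, q, 0⟩ : WeierstrassCurve ℚ).c₄ / (⟨0, -(1 + q), 0, q, 0⟩ : WeierstrassCurve ℚ).c₆)))) :
    letI := T.instFieldF; letI := T.instNumberFieldF; letI := T.instAlgebraF; letI := T.instFieldK
    letI := T.instNumberFieldK; letI := T.instAlgebraK; letI := T.instFieldFbar; letI := T.instAlgebraFbar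
    letI := T.instAlgebraKFbar; letI := T.instIsElliptic
    haveI : Fact (pp : ℕ).Prime := ⟨pp.2⟩
    ∀ x₀ : (thetaIndex (pilotDataOfK T.D T.K)).Fibre (.inr pp),
      2 * l ∣ absRamificationIdx (pp : ℕ) (kOf (pilotDataOfK T.D T.K) pp.1 x₀) := by
  letI := T.instFieldF; letI := T.instNumberFieldF; letI := T.instAlgebraF; letI := T.instFieldK
  letI := T.instNumberFieldK; letI := T.instAlgebraK; letI := T.instFieldFbar; letI := T.instAlgebraFbar
  letI := T.instAlgebraKFbar; letI := T.instIsElliptic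
  haveI : Fact (pp : ℕ).Prime := ⟨pp.2⟩
  intro x₀
  rw [GenuineK.absRamificationIdx_kOf_eq_mul_prime_ratPoint T pp hp2 hpl hpole x₀]
  have hpu : ((pp : ℕ) : 𝓞 T.K) ∈ (placeOf (pilotDataOfK T.D T.K) pp.1 x₀).asIdeal := natCast_mem_placeOf (pilotDataOfK T.D T.K) pp.1 x₀
  have hpw : ((pp : ℕ) : 𝓞 T.F) ∈ (finBelow T.F T.K (placeOf (pilotDataOfK T.D T.K) pp.1 x₀)).asIdeal := by
    change ((pp : ℕ) : 𝓞 T.F) ∈ Ideal.comap (algebraMap (𝓞 T.F) (𝓞 T.K)) (placeOf (pilotDataOfK T.D T.K) pp.1 x₀).asIdeal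
    rw [Ideal.mem_comap, map_natCast]
    exact hpu
  exact mul_dvd_mul (GenuineK.two_dvd_ramificationIdx_F_of_odd_ord_gamma T pp hpole hodd _ hpw) dvd_rfl

end Summit.ABC.IUTFork.Conditional

end
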